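import Summits.AtomisticToContinuum.Crystallization.Theorems.FrustratedLawDichotomyCellCheckerBad
import Summits.AtomisticToContinuum.Crystallization.Theorems.FrustratedLawDichotomyCollarNonExemptBins

/-!
# FrustratedLawDichotomy · crux `AperiodicFrustratedLawGap` (stmt-AtomisticToContinuum-27623) — CELL KIT X: kernel-evaluable checks of the
# EXEMPTION OF RECORD (`MoveUnstableCore ε Rm s`, `RemovalUnstableCore eUp t Rm`) at the class centres of a rational periodic cell
# (decomp-a2c, prover hand 2, generation 17; critic row 592 (3): the (T-X) consumer of the Lean replay `¬(collared pieces at 1/100)`)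

Data model = hand-1's `…CellChecker.Cell` (denominator `DEN`, motif numerators `X`, cell `A`, supercell half-width `k₀`, points `ptN m′ t`, squared
numerator distances `nN m m′ t`).  For the class centre `m` the local set of the exemption predicates is `{q : 0 < nN ≤ Rm²·DEN²}`; every per-bond
quantity of hand-2's closed-form move certificate (`…CollarNonExempt*`) is a function of the integer `n = nN` and the integer vector
`z = ptN m′ t − X m` (`w = y_j − y_k = −z/DEN`):

* §1 rational arithmetic: `roundDown` (to `2⁻⁴⁰`), `vT DEN n = Ṽ(n/DEN²)`, `dvT DEN n = Ṽ'(n/DEN²)` (exact), the allowance `slackQ` and tail `tailQ`;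
* §2 the certificate data `XParams` (literals `Rm, s, ε, eUp, t`), `MoveBin` (a bin `[nlo, nhi]` of squared numerators with length enclosures
  `rlo ≤ √(n)/DEN ≤ rhi` and ONE Bregman constant `cst`), `XCert` (bins, number of chain pieces, and the three scalars `λ, β, φ_F` a checker cannot
  extract by itself because they involve square roots / eigenvalues);
* §3 per-point terms and their sums in hand-1's `Σ_{m′} sumBelow … K³` shape: removal `termV` (rounded UP), `termS` (rounded DOWN), force coordinates
  `termF a` (rounded DOWN; the rounding slack is `τ = N₀K³/2⁴⁰` per coordinate), the EXACT matrix / vector / scalar sums `termC a b`, `termB a`, `termC4`;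
* §4 the Boolean checks `checkParams`, `checkBins` (per bin: enclosures, `s < rlo`, the binned chain condition of `…CollarNonExemptBins`),
  `checkCover` (every in-range point has a bin), `checkRemoval`, `checkMove` (bins + cover + `β, φ_F` enclosures + 3×3 `LDLᵀ` pivots of
  `(S_lo − λ)I + C` + the closed scalar condition `L = λ − βs + min(C₄,0)s² > 0 ∧ φ_F² ≤ 4L·slack`).
Soundness (`…CellKitXSound`): `checkRemoval = true ⟹ ¬RemovalUnstableCore`, `checkMove = true ⟹ ¬MoveUnstableCore` at `cellIdx m` of the
supercell motif `c.zM`.  All `[folklore]`; 0 sorry.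
-/

namespace Summit.AtomisticToContinuum.Crystallization.Theorems.FrustratedLawDichotomyCellKitX

open scoped BigOperators
open Literature.Geometry.DiscreteGeometry (sqNormInt)
open Summit.AtomisticToContinuum.Crystallization.Theorems.FrustratedLawDichotomyCellChecker
  (Cell roundUp le_roundUp allBelow sumBelow allBelow_spec sumBelow_eq)
open Summit.AtomisticToContinuum.Crystallization.Theorems.FrustratedLawDichotomyCellKitF (cellμ cellσ cellIdx cellMid)

/-! ## §1. Rational arithmetic -/

/-- Round a rational DOWN to denominator `2^40`. -/
def roundDown (q : ℚ) : ℚ := (⌊q * 2 ^ 40⌋ : ℚ) / 2 ^ 40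

/-- Rounding down does not increase. [folklore] -/
theorem roundDown_le (q : ℚ) : roundDown q ≤ q := by
  unfold roundDown
  rw [div_le_iff₀ (by positivity)]
  exact Int.floor_le _

/-- Rounding down loses at most `2⁻⁴⁰`. [folklore] -/
theorem sub_roundDown_le (q : ℚ) : q - roundDown q ≤ 1 / 2 ^ 40 := by
  unfold roundDown
  have h := Int.lt_floor_add_one (q * 2 ^ 40)
  have e : q - (⌊q * 2 ^ 40⌋ : ℚ) / 2 ^ 40 = (q * 2 ^ 40 - ⌊q * 2 ^ 40⌋) / 2 ^ 40 := by field_simp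
  rw [e, div_le_div_iff_of_pos_right (by positivity)]
  linarith

/-- `Ṽ(Q) = Q⁻⁶/12 − Q⁻³/6` at `Q = n/DEN²` (exact rational; `V_LJ(r) = Ṽ(r²)`). -/
def vT (DEN n : ℕ) : ℚ := 1 / 12 * ((DEN : ℚ) ^ 2 / n) ^ 6 - 1 / 6 * ((DEN : ℚ) ^ 2 / n) ^ 3

/-- `Ṽ'(Q) = −Q⁻⁷/2 + Q⁻⁴/2` at `Q = n/DEN²` (exact rational). -/
def dvT (DEN n : ℕ) : ℚ := -(1 / 2) * ((DEN : ℚ) ^ 2 / n) ^ 7 + 1 / 2 * ((DEN : ℚ) ^ 2 / n) ^ 4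

/-- The allowance of `MoveUnstableCore ε Rm s`: `ε + s (Rm/(Rm−s))⁷ S₇♯(Rm)`. -/
def slackQ (ε s Rm : ℚ) : ℚ :=
  ε + s * (Rm / (Rm - s)) ^ 7 * (6000 / 343 * Rm⁻¹ ^ 4 + 2880 / 49 * Rm⁻¹ ^ 5 + 10 / 7 * Rm⁻¹ ^ 6 + 2 * Rm⁻¹ ^ 7)

/-- The sharp tail constant `T♯(D)` of `…ExemptLocalSharp.tailConstSharp` as a rational function. -/
def tailQ (D : ℚ) : ℚ := 4000 / 1029 * D⁻¹ ^ 3 + 500 / 49 * D⁻¹ ^ 4 + 2 / 7 * D⁻¹ ^ 5 + 1 / 3 * D⁻¹ ^ 6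

/-- `Pos(u, a)` of the Bregman menu. -/
def posQ (u a : ℚ) : ℚ := u ^ 2 * a * (6 * u ^ 5 + 5 * u ^ 4 * a + 4 * u ^ 3 * a ^ 2 + 3 * u ^ 2 * a ^ 3 + 2 * u * a ^ 4 + a ^ 5)

/-- `Neg(u, b)` of the Bregman menu. -/
def negQ (u b : ℚ) : ℚ := u ^ 2 * b * (6 * u ^ 2 + 4 * u * b + 2 * b ^ 2)

/-! ## §2. Certificate data -/

/-- The literals of the exemption: move cutoff `Rm`, move radius `s`, tolerance `ε`, removal level `eUp`, removal tolerance `tR`. -/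
structure XParams where
  /-- cutoff radius of the local LJ sums -/
  Rm : ℚ
  /-- move radius -/
  s : ℚ
  /-- move tolerance -/
  ε : ℚ
  /-- removal level -/
  eUp : ℚ
  /-- removal tolerance -/
  tR : ℚ

/-- A bin of squared numerator bond lengths `nlo ≤ n ≤ nhi` with rational length enclosures `rlo ≤ √n/DEN ≤ rhi` and its Bregman constant `cst`
(valid for moves of length `≤ s` — certified by `checkBins`). -/
structure MoveBin where
  /-- lower end (squared numerator) -/
  nlo : ℕ
  /-- upper end (squared numerator) -/
  nhi : ℕ
  /-- lower length enclosure -/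
  rlo : ℚ
  /-- upper length enclosure -/
  rhi : ℚ
  /-- Bregman constant of the bin -/
  cst : ℚ

/-- A class move certificate: the bins, the number of chain pieces, and the scalars `λ` (quadratic-form bound), `β ≥ ‖4Σ c_k w_k‖`, `φ_F ≥ ‖F‖`. -/
structure XCert where
  /-- bins covering every in-range bond of the class -/
  bins : List MoveBin
  /-- pieces of the chain subdivision of each bin's move range -/
  npieces : ℕ
  /-- claimed quadratic-form lower bound -/
  lam : ℚ
  /-- claimed bound on `‖4 Σ c_k w_k‖` -/
  beta : ℚ
  /-- claimed bound on the net force `‖Σ 2Ṽ'(Q_k) w_k‖` -/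
  phiF : ℚ

/-- The `i`-th node of the uniform chain on the bin's move range `[(rlo − s)², (rhi + s)²]`. -/
def MoveBin.node (b : MoveBin) (s : ℚ) (np : ℕ) (i : ℕ) : ℚ :=
  (b.rlo - s) ^ 2 + ((b.rhi + s) ^ 2 - (b.rlo - s) ^ 2) * i / np

/-- The bin containing `n` (first match), if any. -/
def binOf (bins : List MoveBin) (n : ℤ) : Option MoveBin :=
  bins.find? fun b => decide ((b.nlo : ℤ) ≤ n) && decide (n ≤ (b.nhi : ℤ))

/-- The Bregman constant assigned to `n` (`0` if uncovered — excluded by `checkCover`). -/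
def cOf (bins : List MoveBin) (n : ℤ) : ℚ := ((binOf bins n).map MoveBin.cst).getD 0

/-! ## §3. Per-point terms and sums -/

variable (c : Cell)

/-- In-range test of a squared numerator distance: `0 < n ≤ Rm²·DEN²`. -/
def inRange (P : XParams) (n : ℤ) : Bool := decide (0 < n) && decide ((n : ℚ) ≤ P.Rm ^ 2 * (c.DEN : ℚ) ^ 2)

/-- The integer vector from the class centre `m` to the supercell point `(m′, t)` (so `w = y_j − y_k = −zvec/DEN`). -/
def zvec (m m' : Fin c.N₀) (t : ℕ) : Fin 3 → ℤ := c.ptN m' t - c.X m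

/-- A sum over the supercell in hand-1's kernel-cheap shape. -/
def sumX (f : Fin c.N₀ → ℕ → ℚ) : ℚ := ∑ m' : Fin c.N₀, sumBelow (f m') c.K3

/-- Removal term: `Ṽ(n/DEN²)` rounded up (in range), else `0`. -/
def termV (P : XParams) (m m' : Fin c.N₀) (t : ℕ) : ℚ :=
  if inRange c P (c.nN m m' t) then roundUp (vT c.DEN (c.nN m m' t).toNat) else 0

/-- `S`-term: `Ṽ'(n/DEN²)` rounded down (in range), else `0`. -/
def termS (P : XParams) (m m' : Fin c.N₀) (t : ℕ) : ℚ :=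
  if inRange c P (c.nN m m' t) then roundDown (dvT c.DEN (c.nN m m' t).toNat) else 0

/-- Force coordinate term: `2Ṽ'(Q)·w_a = −2Ṽ'(Q) z_a/DEN` rounded down (in range), else `0`. -/
def termF (P : XParams) (a : Fin 3) (m m' : Fin c.N₀) (t : ℕ) : ℚ :=
  if inRange c P (c.nN m m' t) then roundDown (2 * dvT c.DEN (c.nN m m' t).toNat * (-(zvec c m m' t a : ℚ)) / c.DEN) else 0

/-- Matrix term: `4 c_k w_a w_b = 4 c z_a z_b / DEN²` (exact; in range), else `0`. -/
def termC (P : XParams) (bins : List MoveBin) (a b : Fin 3) (m m' : Fin c.N₀) (t : ℕ) : ℚ :=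
  if inRange c P (c.nN m m' t) then 4 * cOf bins (c.nN m m' t) * ((zvec c m m' t a : ℚ) * (zvec c m m' t b)) / (c.DEN : ℚ) ^ 2 else 0

/-- Vector term: `4 c_k w_a = −4 c z_a / DEN` (exact; in range), else `0`. -/
def termB (P : XParams) (bins : List MoveBin) (a : Fin 3) (m m' : Fin c.N₀) (t : ℕ) : ℚ :=
  if inRange c P (c.nN m m' t) then 4 * cOf bins (c.nN m m' t) * (-(zvec c m m' t a : ℚ)) / c.DEN else 0

/-- Scalar term: `c_k` (in range), else `0`. -/
def termC4 (P : XParams) (bins : List MoveBin) (m m' : Fin c.N₀) (t : ℕ) : ℚ :=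
  if inRange c P (c.nN m m' t) then cOf bins (c.nN m m' t) else 0

/-! ## §4. The checks -/

/-- Parameter check: `0 < s < Rm`, `0 < s < 7/10` (the predicate's hard-core guard is then automatic), plus the supercell margin for the
X-kernel transport `cB·(Rm + Dq) < k₀ + 1` and `Rm ≤ k₀`-independent sanity `0 < DEN`. -/
def checkParams (P : XParams) : Bool :=
  decide (0 < c.DEN) && decide (0 < P.s) && decide (P.s < P.Rm) && decide (P.s < 7 / 10) && decide (c.cB * (P.Rm + c.Dq) < c.k₀ + 1)

/-- Bin check: positivity/enclosures, `s < rlo`, and the BINNED CHAIN CONDITION of `…CollarNonExemptBins.bregman_ge_of_bin_chain` on `npieces`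
uniform pieces of `[(rlo − s)², (rhi + s)²]` (`Q_hi⁻¹ = DEN²/nhi` in `Pos`, `Q_lo⁻¹ = DEN²/nlo` in `Neg`). -/
def checkBin (P : XParams) (np : ℕ) (b : MoveBin) : Bool :=
  decide (0 < b.nlo) && decide (b.nlo ≤ b.nhi) && decide (0 ≤ b.rlo) && decide (0 ≤ b.rhi) &&
  decide (b.rlo ^ 2 * (c.DEN : ℚ) ^ 2 ≤ b.nlo) && decide ((b.nhi : ℚ) ≤ b.rhi ^ 2 * (c.DEN : ℚ) ^ 2) && decide (P.s < b.rlo) && decide (0 < np) &&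
  allBelow (fun i => decide (12 * b.cst ≤
      posQ ((c.DEN : ℚ) ^ 2 / b.nhi) (b.node P.s np (i + 1))⁻¹ - negQ ((c.DEN : ℚ) ^ 2 / b.nlo) (b.node P.s np i)⁻¹)) np

/-- All bins pass. -/
def checkBins (P : XParams) (X : XCert) : Bool := X.bins.all (checkBin c P X.npieces)

/-- Every in-range supercell point of class `m` lies in some bin. -/
def checkCover (P : XParams) (X : XCert) (m : Fin c.N₀) : Bool :=
  decide (∀ m' : Fin c.N₀, allBelow (fun t => !inRange c P (c.nN m m' t) || (binOf X.bins (c.nN m m' t)).isSome) c.K3 = true)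

/-- ★ REMOVAL CHECK for class `m`: `Σ_{in range} Ṽ(Q)↑ ≤ eUp + tR + T♯(Rm)`. -/
def checkRemoval (P : XParams) (m : Fin c.N₀) : Bool :=
  decide (sumX c (termV c P m) ≤ P.eUp + P.tR + tailQ P.Rm)

/-- The rounding slack of one force coordinate: one `2⁻⁴⁰` per supercell point. -/
def tauOf : ℚ := ((c.N₀ * c.K3 : ℕ) : ℚ) / 2 ^ 40

/-- ★★ MOVE CHECK for class `m` (one zone, isotropic certificate of `…CollarNonExempt.not_moveUnstableCore_of_bregmanCert_closed`):
bins + cover + `β` and `φ_F` from coordinate sums + the `LDLᵀ` pivots of `(S_lo − λ)I + 4Σ c_k w_k w_kᵀ` + the closed scalar condition. -/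
def checkMove (P : XParams) (X : XCert) (m : Fin c.N₀) : Bool :=
  let Slo := sumX c (termS c P m)
  let f0 := sumX c (termF c P 0 m)
  let f1 := sumX c (termF c P 1 m)
  let f2 := sumX c (termF c P 2 m)
  let C00 := sumX c (termC c P X.bins 0 0 m)
  let C01 := sumX c (termC c P X.bins 0 1 m)
  let C02 := sumX c (termC c P X.bins 0 2 m)
  let C11 := sumX c (termC c P X.bins 1 1 m)
  let C12 := sumX c (termC c P X.bins 1 2 m)
  let C22 := sumX c (termC c P X.bins 2 2 m)
  let B0 := sumX c (termB c P X.bins 0 m)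
  let B1 := sumX c (termB c P X.bins 1 m)
  let B2 := sumX c (termB c P X.bins 2 m)
  let C4 := sumX c (termC4 c P X.bins m)
  let τ := tauOf c
  let d0 := Slo + C00 - X.lam
  let l10 := C01 / d0
  let l20 := C02 / d0
  let d1 := Slo + C11 - X.lam - l10 ^ 2 * d0
  let l21 := (C12 - l20 * l10 * d0) / d1
  let d2 := Slo + C22 - X.lam - l20 ^ 2 * d0 - l21 ^ 2 * d1
  let C4m := min C4 0
  let L := X.lam - X.beta * P.s + C4m * P.s ^ 2
  checkBins c P X && checkCover c P X m &&
  decide (0 ≤ X.beta) && decide (B0 ^ 2 + B1 ^ 2 + B2 ^ 2 ≤ X.beta ^ 2) &&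
  decide (0 ≤ X.phiF) && decide ((|f0| + τ) ^ 2 + (|f1| + τ) ^ 2 + (|f2| + τ) ^ 2 ≤ X.phiF ^ 2) &&
  decide (0 < d0) && decide (0 < d1) && decide (0 ≤ d2) &&
  decide (0 < L) && decide (X.phiF ^ 2 ≤ 4 * L * slackQ P.ε P.s P.Rm)

end Summit.AtomisticToContinuum.Crystallization.Theorems.FrustratedLawDichotomyCellKitX
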